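import Summits.BirchSwinnertonDyer.BirchSwinnertonDyer.Theorems.BiquadraticEisensteinDescentManinDatumSupercuspidalCMInertSevenDivisionField
import Literature.NumberTheory.LFunctions.GaussianThetaSeries
import Mathlib.FieldTheory.Normal.Closure
import Mathlib.FieldTheory.Galois.Basic
import Mathlib.Analysis.Complex.Polynomial.Basic
import HarnessLib

set_option linter.dupNamespace false -- `Summit.BirchSwinnertonDyer.BirchSwinnertonDyer.Theorems.…` (summit = sub, D-0017)
set_option autoImplicit false

/-!
# Crux `ManinDatumSupercuspidalCMInert` (stmt-BirchSwinnertonDyer-20111, BED r605), CM side of H₇ — step (d) of memo PLAIN-ODD-57,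
# fourth brick (b): EMBEDDINGS of a field containing the `7`-division values of `y² = x³ − x` over `ℚ(i)` permute the division points
# `P_c = (X_c, Y_c)` `ℤ[i]`-LINEARLY: `φ(P_c) = P_{u·c}` for one `u ∈ (ℤ[i]/7)ˣ`

Route `BiquadraticEisensteinDescent` (cell `pub/bsd-wall`, width seat `bsd-wall-cm-bed-w4` g11, RESOLVENT/GALOIS LANE; `--supports`
stmt-BirchSwinnertonDyer-20111, helper). THEOREMS ONLY (no definition, no named fact, no `sorry`); nothing is closed by this file and BSD is
not proved by any of it.

For an intermediate field `K` of `ℂ/ℚ⟮i⟯` containing all `X_c = ℘(c/7)/ϖ₀²`, `Y_c = ℘′(c/7)/(2ϖ₀³)` (`c ∈ ℤ[i] ∖ 7ℤ[i]`) and a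
`ℚ⟮i⟯`-algebra map `φ : K → ℂ`:
* `exists_apply_eq` — `φ(P_c)` is again a `7`-division point `P_d` (`ψ₇` has integer coefficients; `…SevenDivisionField.exists_eq_division_point`);
* `dvd_sub_of_X_Y_eq` — `P_u = P_{u′} ⇒ u ≡ u′ (mod 7)`;
* ★ `exists_mul_of_algHom` — **`φ(P_c) = P_{u c}` for all `c`, for one `u ∉ 7ℤ[i]`** (`φ` respects the chord law — the addition theorems
  `normalizedX_add` / `normalizedY_add` are identities between elements of `K` with coefficients in `ℚ` — and commutes with `[i]` because it
  fixes `i`; then `…SevenDivisionPoints.induction_mod_seven`). This is «`Gal` acts on `E₀[7] ≅ ℤ[i]/7` through `(ℤ[i]/7)ˣ`»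
  without Galois representations;
* `algHom_apply_mem_adjoin`, `normal_adjoin`, `isGalois_adjoin` — for `K₇ := ℚ⟮i⟯(X_c, Y_c : c)` every embedding lands in `K₇`
  (`normalClosure ≤ K₇`), so `K₇/ℚ⟮i⟯` is finite Galois (the `7`-division field of `y² = x³ − x` over `ℚ(i)`).

The sequel (`…SevenDivisionGaloisCount`) counts: `[K₇ : ℚ(i)] = 48` and `Gal(K₇/ℚ(i)) ≅ (ℤ[i]/7)ˣ`.
References: [SilvermanAEC2009] III.1, VI.3.6, Ex. 3.7; [SilvermanATAEC1994] II.2 (Thm. 2.3: `Gal` commutes with CM endomorphisms defined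
over the base), II.5; [Serre1979] Ch. IV §2.
-/

noncomputable section

open Complex PeriodPair Polynomial
open scoped PeriodPair IntermediateField
open Literature.NumberTheory.EllipticCurves Literature.NumberTheory.EllipticCurves.GaussianLattice
open Literature.NumberTheory.LFunctions.GaussianTheta

namespace Summit.BirchSwinnertonDyer.BirchSwinnertonDyer.Theorems.BiquadraticEisensteinDescentManinDatumSupercuspidalCMInertSevenDivisionGalois

open Summit.BirchSwinnertonDyer.BirchSwinnertonDyer.Theorems.BiquadraticEisensteinDescentManinDatumSupercuspidalCMInertSevenDivisionEisenstein
  (psi_seven_weierstrassP_div)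
open Summit.BirchSwinnertonDyer.BirchSwinnertonDyer.Theorems.BiquadraticEisensteinDescentManinDatumSupercuspidalCMInertFormalChord
  (normalizedX_add)
open Summit.BirchSwinnertonDyer.BirchSwinnertonDyer.Theorems.BiquadraticEisensteinDescentManinDatumSupercuspidalCMInertSevenDivisionPoints
open Summit.BirchSwinnertonDyer.BirchSwinnertonDyer.Theorems.BiquadraticEisensteinDescentManinDatumSupercuspidalCMInertSevenDivisionTameCharacter
  (normalizedY_add)
open Summit.BirchSwinnertonDyer.BirchSwinnertonDyer.Theorems.BiquadraticEisensteinDescentManinDatumSupercuspidalCMInertSevenDivisionField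

/-! ## §5 Embeddings permute the division points `ℤ[i]`-linearly -/

section Embeddings

variable (K : IntermediateField ℚ⟮I⟯ ℂ)
  (hXK : ∀ c : GaussianInt, ¬ (7 : GaussianInt) ∣ c →
    ℘[ofUpperHalfPlane UpperHalfPlane.I] (((c : GaussianInt) : ℂ) / 7) / ((Real.Gamma (1 / 4) ^ 2 / (2 * Real.sqrt (2 * Real.pi)) : ℝ) : ℂ) ^ 2 ∈ K)
  (hYK : ∀ c : GaussianInt, ¬ (7 : GaussianInt) ∣ c →
    ℘'[ofUpperHalfPlane UpperHalfPlane.I] (((c : GaussianInt) : ℂ) / 7) / (2 * ((Real.Gamma (1 / 4) ^ 2 / (2 * Real.sqrt (2 * Real.pi)) : ℝ) : ℂ) ^ 3) ∈ K)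

/-- `7` is prime in `ℤ[i]` (`7 ≡ 3 (mod 4)` is inert). [cite: IrelandRosen1982, Ch. 9 §7 Lemma 4] -/
theorem prime_seven : Prime (7 : GaussianInt) := by
  have h := Literature.NumberTheory.QuadraticFields.GaussianQuarticSymbol.prime_natCast_of_mod_four_eq_three' (q := 7)
    (by norm_num) (by norm_num)
  simpa using h

/-- `7 ∤ 1` in `ℤ[i]`. [folklore] -/
theorem not_seven_dvd_one : ¬ (7 : GaussianInt) ∣ 1 := fun h ↦ by
  have := (seven_dvd_iff 1).mp h; norm_num at this

/-- `7 ∤ u, 7 ∤ c ⇒ 7 ∤ uc`. [folklore] -/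
theorem not_seven_dvd_mul {u c : GaussianInt} (hu : ¬ (7 : GaussianInt) ∣ u) (hc : ¬ (7 : GaussianInt) ∣ c) :
    ¬ (7 : GaussianInt) ∣ u * c := fun h ↦ by
  rcases prime_seven.dvd_or_dvd h with h' | h'
  exacts [hu h', hc h']

include hXK hYK in
/-- **An embedding maps a `7`-division point to a `7`-division point**: for a `ℚ⟮i⟯`-algebra map `φ : K → ℂ` and `7 ∤ c` there is
`d ∉ 7ℤ[i]` with `φ(X_c) = X_d`, `φ(Y_c) = Y_d` (`ψ₇` and `y² = x³ − x` have rational coefficients). [cite: SilvermanAEC2009, VIII.1 (Galois action on E[m])] -/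
theorem exists_apply_eq (φ : K →ₐ[ℚ⟮I⟯] ℂ) {c : GaussianInt} (hc : ¬ (7 : GaussianInt) ∣ c) :
    ∃ d : GaussianInt, ¬ (7 : GaussianInt) ∣ d ∧
      φ ⟨_, hXK c hc⟩ = ℘[ofUpperHalfPlane UpperHalfPlane.I] (((d : GaussianInt) : ℂ) / 7) / ((Real.Gamma (1 / 4) ^ 2 / (2 * Real.sqrt (2 * Real.pi)) : ℝ) : ℂ) ^ 2 ∧
      φ ⟨_, hYK c hc⟩ = ℘'[ofUpperHalfPlane UpperHalfPlane.I] (((d : GaussianInt) : ℂ) / 7) / (2 * ((Real.Gamma (1 / 4) ^ 2 / (2 * Real.sqrt (2 * Real.pi)) : ℝ) : ℂ) ^ 3) := by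
  obtain ⟨hψ, hcurve⟩ := psi_seven_weierstrassP_div (div_seven_notMem hc) (seven_mul_div_seven_mem c)
  set eX : K := ⟨_, hXK c hc⟩ with heX
  set eY : K := ⟨_, hYK c hc⟩ with heY
  -- the two equations hold in `K`
  have hψK : 7 * eX ^ 24 - 308 * eX ^ 22 - 2954 * eX ^ 20 + 19852 * eX ^ 18 - 35231 * eX ^ 16 + 82264 * eX ^ 14
      - 111916 * eX ^ 12 + 42168 * eX ^ 10 + 15673 * eX ^ 8 - 14756 * eX ^ 6 + 1302 * eX ^ 4 - 196 * eX ^ 2 - 1 = 0 := by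
    apply Subtype.ext
    push_cast
    exact hψ
  have hcurveK : eY ^ 2 = eX ^ 3 - eX := by
    apply Subtype.ext
    push_cast
    exact hcurve
  -- transport through `φ`
  have hψ' := congrArg φ hψK
  have hcurve' := congrArg φ hcurveK
  simp only [map_sub, map_add, map_mul, map_pow, map_ofNat, map_one, map_zero] at hψ' hcurve'
  exact exists_eq_division_point hψ' hcurve'

/-- `Y_c ≠ 0` for `7 ∤ c` (`℘′(z) = 0` only at `2`-division points). [folklore] -/
theorem Y_ne_zero {c : GaussianInt} (hc : ¬ (7 : GaussianInt) ∣ c) :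
    ℘'[ofUpperHalfPlane UpperHalfPlane.I] (((c : GaussianInt) : ℂ) / 7) / (2 * ((Real.Gamma (1 / 4) ^ 2 / (2 * Real.sqrt (2 * Real.pi)) : ℝ) : ℂ) ^ 3) ≠ 0 := by
  intro h
  have hϖ0 : ((Real.Gamma (1 / 4) ^ 2 / (2 * Real.sqrt (2 * Real.pi)) : ℝ) : ℂ) ≠ 0 := Complex.ofReal_ne_zero.mpr varpi_pos.ne'
  have h' : ℘'[ofUpperHalfPlane UpperHalfPlane.I] (((c : GaussianInt) : ℂ) / 7) = 0 := by
    rcases div_eq_zero_iff.mp h with h0 | h0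
    · exact h0
    · exact absurd h0 (mul_ne_zero two_ne_zero (pow_ne_zero 3 hϖ0))
  have h2 := (ofUpperHalfPlane UpperHalfPlane.I).two_mul_mem_lattice_of_derivWeierstrassP_eq_zero (div_seven_notMem hc) h'
  have : (2 : ℂ) * (((c : GaussianInt) : ℂ) / 7) = (((2 * c : GaussianInt)) : ℂ) / 7 := by rw [map_mul, map_ofNat]; ring
  rw [this, div_seven_mem_lattice_iff] at h2
  rcases prime_seven.dvd_or_dvd h2 with h7 | h7
  · have := (seven_dvd_iff 2).mp h7; norm_num at this
  · exact hc h7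

/-- **`P_u = P_{u′} ⇒ u ≡ u′ (mod 7)`**: `X_u = X_{u′}` gives `u ≡ ±u′`, and `u ≡ −u′` would force `Y_{u′} = −Y_{u′} = 0`. [folklore] -/
theorem dvd_sub_of_X_Y_eq {u u' : GaussianInt} (hu : ¬ (7 : GaussianInt) ∣ u) (hu' : ¬ (7 : GaussianInt) ∣ u')
    (hX : ℘[ofUpperHalfPlane UpperHalfPlane.I] (((u : GaussianInt) : ℂ) / 7) / ((Real.Gamma (1 / 4) ^ 2 / (2 * Real.sqrt (2 * Real.pi)) : ℝ) : ℂ) ^ 2 =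
      ℘[ofUpperHalfPlane UpperHalfPlane.I] (((u' : GaussianInt) : ℂ) / 7) / ((Real.Gamma (1 / 4) ^ 2 / (2 * Real.sqrt (2 * Real.pi)) : ℝ) : ℂ) ^ 2)
    (hY : ℘'[ofUpperHalfPlane UpperHalfPlane.I] (((u : GaussianInt) : ℂ) / 7) / (2 * ((Real.Gamma (1 / 4) ^ 2 / (2 * Real.sqrt (2 * Real.pi)) : ℝ) : ℂ) ^ 3) =
      ℘'[ofUpperHalfPlane UpperHalfPlane.I] (((u' : GaussianInt) : ℂ) / 7) / (2 * ((Real.Gamma (1 / 4) ^ 2 / (2 * Real.sqrt (2 * Real.pi)) : ℝ) : ℂ) ^ 3)) :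
    (7 : GaussianInt) ∣ u - u' := by
  rcases (X_eq_X_iff hu hu').mp hX with hsum | hdiff
  · exfalso
    -- `u ≡ −u′`: `Y_u = Y_{−u′} = −Y_{u′}`, so `Y_{u′} = −Y_{u′} = 0`
    have h7 : (7 : GaussianInt) ∣ u - (-u') := by rw [sub_neg_eq_add]; exact hsum
    have hY' := (X_Y_eq_of_dvd_sub h7).2
    have hneg := (X_Y_neg u').2
    apply Y_ne_zero hu'
    have e := hY.symm.trans (hY'.trans hneg)
    linear_combination e / 2
  · exact hdiff

include hXK hYK in
/-- ★ **Embeddings act `ℤ[i]`-linearly on `E₀[7]`.** For every `ℚ⟮i⟯`-algebra map `φ : K → ℂ` there is `u ∈ ℤ[i] ∖ 7ℤ[i]` with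
`φ(X_c) = X_{uc}` and `φ(Y_c) = Y_{uc}` for ALL `c ∉ 7ℤ[i]`: `φ` is compatible with the chord law (addition theorems with rational
coefficients) and with `[i](x, y) = (−x, iy)` (it fixes `i`), so `c ↦ (label of φ(P_c))` is additive and `ℤ[i]`-linear modulo `7`.
[cite: SilvermanATAEC1994, II.2 Thm. 2.3] [cite: SilvermanAEC2009, III.2.3] -/
theorem exists_mul_of_algHom (φ : K →ₐ[ℚ⟮I⟯] ℂ) :
    ∃ u : GaussianInt, ¬ (7 : GaussianInt) ∣ u ∧ ∀ (c : GaussianInt) (hc : ¬ (7 : GaussianInt) ∣ c),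
      φ ⟨_, hXK c hc⟩ = ℘[ofUpperHalfPlane UpperHalfPlane.I] (((u * c : GaussianInt) : ℂ) / 7) / ((Real.Gamma (1 / 4) ^ 2 / (2 * Real.sqrt (2 * Real.pi)) : ℝ) : ℂ) ^ 2 ∧
      φ ⟨_, hYK c hc⟩ = ℘'[ofUpperHalfPlane UpperHalfPlane.I] (((u * c : GaussianInt) : ℂ) / 7) / (2 * ((Real.Gamma (1 / 4) ^ 2 / (2 * Real.sqrt (2 * Real.pi)) : ℝ) : ℂ) ^ 3) := by
  obtain ⟨u, hu, hX1, hY1⟩ := exists_apply_eq K hXK hYK φ not_seven_dvd_one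
  refine ⟨u, hu, fun c hc ↦ ?_⟩
  -- abbreviations inside the proof
  set ϖ : ℂ := ((Real.Gamma (1 / 4) ^ 2 / (2 * Real.sqrt (2 * Real.pi)) : ℝ) : ℂ) with hϖ
  have hIK : I ∈ K := by
    have := K.algebraMap_mem ⟨I, I_mem_adjoin_I⟩
    exact this
  have hφI : φ ⟨I, hIK⟩ = I := by
    have : (⟨I, hIK⟩ : K) = algebraMap ℚ⟮I⟯ K ⟨I, I_mem_adjoin_I⟩ := rfl
    rw [this, φ.commutes]; rfl
  refine (induction_mod_seven
    (P := fun c ↦ ∀ hc : ¬ (7 : GaussianInt) ∣ c,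
      φ ⟨_, hXK c hc⟩ = ℘[ofUpperHalfPlane UpperHalfPlane.I] (((u * c : GaussianInt) : ℂ) / 7) / ϖ ^ 2 ∧
      φ ⟨_, hYK c hc⟩ = ℘'[ofUpperHalfPlane UpperHalfPlane.I] (((u * c : GaussianInt) : ℂ) / 7) / (2 * ϖ ^ 3))
    ?_ ?_ ?_ ?_ ?_ c hc) hc
  · -- `c = 1`
    intro _
    rw [mul_one]
    exact ⟨hX1, hY1⟩
  · -- `c ↦ i c`
    intro w hw hP hiw
    obtain ⟨hXw, hYw⟩ := hP hw
    have hmul : u * (⟨0, 1⟩ * w) = ⟨0, 1⟩ * (u * w) := by ring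
    obtain ⟨hXi, hYi⟩ := X_Y_I_mul w
    obtain ⟨hXi', hYi'⟩ := X_Y_I_mul (u * w)
    constructor
    · have e : (⟨_, hXK _ hiw⟩ : K) = -⟨_, hXK w hw⟩ := by
        apply Subtype.ext; push_cast; exact hXi
      rw [e, map_neg, hXw, hmul, hXi']
    · have e : (⟨_, hYK _ hiw⟩ : K) = ⟨I, hIK⟩ * ⟨_, hYK w hw⟩ := by
        apply Subtype.ext; push_cast; exact hYi
      rw [e, map_mul, hφI, hYw, hmul, hYi']
  · -- `c ↦ −c`
    intro w hw hP hnw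
    obtain ⟨hXw, hYw⟩ := hP hw
    have hmul : u * -w = -(u * w) := by ring
    obtain ⟨hXn, hYn⟩ := X_Y_neg w
    obtain ⟨hXn', hYn'⟩ := X_Y_neg (u * w)
    constructor
    · have e : (⟨_, hXK _ hnw⟩ : K) = ⟨_, hXK w hw⟩ := by
        apply Subtype.ext; exact hXn
      rw [e, hXw, hmul, hXn']
    · have e : (⟨_, hYK _ hnw⟩ : K) = -⟨_, hYK w hw⟩ := by
        apply Subtype.ext; push_cast; exact hYn
      rw [e, map_neg, hYw, hmul, hYn']
  · -- `c ≡ c′ (mod 7)`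
    intro w w' hw hww' hP hw'
    obtain ⟨hXw, hYw⟩ := hP hw
    obtain ⟨hXe, hYe⟩ := X_Y_eq_of_dvd_sub hww'
    have h7u : (7 : GaussianInt) ∣ u * w' - u * w := by rw [← mul_sub]; exact Dvd.dvd.mul_left hww' u
    obtain ⟨hXe', hYe'⟩ := X_Y_eq_of_dvd_sub h7u
    constructor
    · have e : (⟨_, hXK _ hw'⟩ : K) = ⟨_, hXK w hw⟩ := by apply Subtype.ext; exact hXe
      rw [e, hXw, ← hXe']
    · have e : (⟨_, hYK _ hw'⟩ : K) = ⟨_, hYK w hw⟩ := by apply Subtype.ext; exact hYe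
      rw [e, hYw, ← hYe']
  · -- generic sums
    intro w w' hw hw' hs hm _ _ hP hP' hsw
    obtain ⟨hXw, hYw⟩ := hP hw
    obtain ⟨hXw', hYw'⟩ := hP' hw'
    -- the addition theorems for `(w, w′)` and for `(uw, uw′)`
    have hne : ℘[ofUpperHalfPlane UpperHalfPlane.I] (((w : GaussianInt) : ℂ) / 7) ≠
        ℘[ofUpperHalfPlane UpperHalfPlane.I] (((w' : GaussianInt) : ℂ) / 7) := fun h ↦
      X_ne_X hw hw' hs hm (by rw [h])
    have hus : ¬ (7 : GaussianInt) ∣ u * w + u * w' := by rw [← mul_add]; exact not_seven_dvd_mul hu hs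
    have hum : ¬ (7 : GaussianInt) ∣ u * w - u * w' := by rw [← mul_sub]; exact not_seven_dvd_mul hu hm
    have huw := not_seven_dvd_mul hu hw
    have huw' := not_seven_dvd_mul hu hw'
    have hne' : ℘[ofUpperHalfPlane UpperHalfPlane.I] (((u * w : GaussianInt) : ℂ) / 7) ≠
        ℘[ofUpperHalfPlane UpperHalfPlane.I] (((u * w' : GaussianInt) : ℂ) / 7) := fun h ↦
      X_ne_X huw huw' hus hum (by rw [h])
    have hadd : (((w + w' : GaussianInt)) : ℂ) / 7 = ((w : GaussianInt) : ℂ) / 7 + ((w' : GaussianInt) : ℂ) / 7 := by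
      rw [map_add, add_div]
    have hadd' : (((u * (w + w') : GaussianInt)) : ℂ) / 7 = ((u * w : GaussianInt) : ℂ) / 7 + ((u * w' : GaussianInt) : ℂ) / 7 := by
      rw [mul_add, map_add, add_div]
    have hXs := normalizedX_add (div_seven_notMem hw) (div_seven_notMem hw') hne
    have hYs := normalizedY_add (div_seven_notMem hw) (div_seven_notMem hw') hne
    have hXs' := normalizedX_add (div_seven_notMem huw) (div_seven_notMem huw') hne'
    have hYs' := normalizedY_add (div_seven_notMem huw) (div_seven_notMem huw') hne'
    rw [← hadd] at hXs hYs
    rw [← hadd'] at hXs' hYs'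
    -- the sum point as a rational expression of `P_w`, `P_{w′}` inside `K`
    set eX : K := ⟨_, hXK w hw⟩ with heX
    set eY : K := ⟨_, hYK w hw⟩ with heY
    set eX' : K := ⟨_, hXK w' hw'⟩ with heX'
    set eY' : K := ⟨_, hYK w' hw'⟩ with heY'
    have hsubK : (eX : ℂ) - eX' ≠ 0 := by
      rw [sub_ne_zero]; exact X_ne_X hw hw' hs hm
    have eXs : (⟨_, hXK _ hsw⟩ : K) = ((eY - eY') / (eX - eX')) ^ 2 - eX - eX' := by
      apply Subtype.ext; push_cast; exact hXs
    have eYs : (⟨_, hYK _ hsw⟩ : K) = -(eY + (eY - eY') / (eX - eX') * (((eY - eY') / (eX - eX')) ^ 2 - eX - eX' - eX)) := by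
      apply Subtype.ext; push_cast; rw [← hXs]; exact hYs
    constructor
    · rw [eXs, map_sub, map_sub, map_pow, map_div₀, map_sub, map_sub, hXw, hYw, hXw', hYw', hXs']
    · rw [eYs, map_neg, map_add, map_mul, map_div₀, map_sub, map_sub, map_sub, map_sub, map_sub, map_pow, map_div₀, map_sub, map_sub,
        hXw, hYw, hXw', hYw', hYs', hXs']

end Embeddings

/-! ## §6 The `7`-division field `K₇ = ℚ(i)(X_c, Y_c : c)` is finite Galois over `ℚ(i)` -/

section DivisionField

/-- `X_c ∈ K₇`. [folklore] -/
theorem X_mem_adjoin {c : GaussianInt} (hc : ¬ (7 : GaussianInt) ∣ c) :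
    ℘[ofUpperHalfPlane UpperHalfPlane.I] (((c : GaussianInt) : ℂ) / 7) / ((Real.Gamma (1 / 4) ^ 2 / (2 * Real.sqrt (2 * Real.pi)) : ℝ) : ℂ) ^ 2 ∈
      IntermediateField.adjoin ℚ⟮I⟯ {x : ℂ | ∃ c : GaussianInt, ¬ (7 : GaussianInt) ∣ c ∧
        (x = ℘[ofUpperHalfPlane UpperHalfPlane.I] (((c : GaussianInt) : ℂ) / 7) / ((Real.Gamma (1 / 4) ^ 2 / (2 * Real.sqrt (2 * Real.pi)) : ℝ) : ℂ) ^ 2 ∨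
         x = ℘'[ofUpperHalfPlane UpperHalfPlane.I] (((c : GaussianInt) : ℂ) / 7) / (2 * ((Real.Gamma (1 / 4) ^ 2 / (2 * Real.sqrt (2 * Real.pi)) : ℝ) : ℂ) ^ 3))} :=
  IntermediateField.subset_adjoin _ _ ⟨c, hc, Or.inl rfl⟩

/-- `Y_c ∈ K₇`. [folklore] -/
theorem Y_mem_adjoin {c : GaussianInt} (hc : ¬ (7 : GaussianInt) ∣ c) :
    ℘'[ofUpperHalfPlane UpperHalfPlane.I] (((c : GaussianInt) : ℂ) / 7) / (2 * ((Real.Gamma (1 / 4) ^ 2 / (2 * Real.sqrt (2 * Real.pi)) : ℝ) : ℂ) ^ 3) ∈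
      IntermediateField.adjoin ℚ⟮I⟯ {x : ℂ | ∃ c : GaussianInt, ¬ (7 : GaussianInt) ∣ c ∧
        (x = ℘[ofUpperHalfPlane UpperHalfPlane.I] (((c : GaussianInt) : ℂ) / 7) / ((Real.Gamma (1 / 4) ^ 2 / (2 * Real.sqrt (2 * Real.pi)) : ℝ) : ℂ) ^ 2 ∨
         x = ℘'[ofUpperHalfPlane UpperHalfPlane.I] (((c : GaussianInt) : ℂ) / 7) / (2 * ((Real.Gamma (1 / 4) ^ 2 / (2 * Real.sqrt (2 * Real.pi)) : ℝ) : ℂ) ^ 3))} :=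
  IntermediateField.subset_adjoin _ _ ⟨c, hc, Or.inr rfl⟩

/-- **Every `ℚ⟮i⟯`-embedding of `K₇` into `ℂ` lands in `K₇`** (generators go to generators by `exists_mul_of_algHom`).
[cite: SilvermanAEC2009, VIII.1 (`K(E[m])/K` is Galois)] -/
theorem algHom_apply_mem_adjoin
    (φ : IntermediateField.adjoin ℚ⟮I⟯ {x : ℂ | ∃ c : GaussianInt, ¬ (7 : GaussianInt) ∣ c ∧
        (x = ℘[ofUpperHalfPlane UpperHalfPlane.I] (((c : GaussianInt) : ℂ) / 7) / ((Real.Gamma (1 / 4) ^ 2 / (2 * Real.sqrt (2 * Real.pi)) : ℝ) : ℂ) ^ 2 ∨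
         x = ℘'[ofUpperHalfPlane UpperHalfPlane.I] (((c : GaussianInt) : ℂ) / 7) / (2 * ((Real.Gamma (1 / 4) ^ 2 / (2 * Real.sqrt (2 * Real.pi)) : ℝ) : ℂ) ^ 3))}
      →ₐ[ℚ⟮I⟯] ℂ) (x : _) :
    φ x ∈ IntermediateField.adjoin ℚ⟮I⟯ {x : ℂ | ∃ c : GaussianInt, ¬ (7 : GaussianInt) ∣ c ∧
        (x = ℘[ofUpperHalfPlane UpperHalfPlane.I] (((c : GaussianInt) : ℂ) / 7) / ((Real.Gamma (1 / 4) ^ 2 / (2 * Real.sqrt (2 * Real.pi)) : ℝ) : ℂ) ^ 2 ∨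
         x = ℘'[ofUpperHalfPlane UpperHalfPlane.I] (((c : GaussianInt) : ℂ) / 7) / (2 * ((Real.Gamma (1 / 4) ^ 2 / (2 * Real.sqrt (2 * Real.pi)) : ℝ) : ℂ) ^ 3))} := by
  obtain ⟨u, hu, hφ⟩ := exists_mul_of_algHom _ (fun c hc ↦ X_mem_adjoin hc) (fun c hc ↦ Y_mem_adjoin hc) φ
  obtain ⟨x, hx⟩ := x
  induction hx using IntermediateField.adjoin_induction with
  | mem x hx =>
    obtain ⟨c, hc, rfl | rfl⟩ := hx
    · rw [(hφ c hc).1]; exact X_mem_adjoin (not_seven_dvd_mul hu hc)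
    · rw [(hφ c hc).2]; exact Y_mem_adjoin (not_seven_dvd_mul hu hc)
  | algebraMap a =>
    change φ (algebraMap ℚ⟮I⟯ _ a) ∈ _
    rw [φ.commutes]
    exact IntermediateField.algebraMap_mem _ a
  | add x y hx hy ihx ihy =>
    change φ (⟨x, hx⟩ + ⟨y, hy⟩) ∈ _
    rw [map_add]; exact add_mem ihx ihy
  | inv x hx ihx =>
    change φ ((⟨x, hx⟩)⁻¹) ∈ _
    rw [map_inv₀]; exact inv_mem ihx
  | mul x y hx hy ihx ihy =>
    change φ (⟨x, hx⟩ * ⟨y, hy⟩) ∈ _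
    rw [map_mul]; exact mul_mem ihx ihy

/-- `7 ∤ rep(b)` for `b ≠ 0` in `(ℤ/7)²` (the canonical representative has coordinates in `[0, 7)`). [folklore] -/
theorem not_seven_dvd_rep {b : ZMod 7 × ZMod 7} (hb : b ≠ 0) : ¬ (7 : GaussianInt) ∣ rep 7 b 0 := by
  intro h
  rw [seven_dvd_iff] at h
  simp only [rep_re, rep_im, Prod.snd_zero, Prod.fst_zero, mul_zero, add_zero] at h
  apply hb
  have h1 : b.1.val = 0 := by have := ZMod.val_lt b.1; omega
  have h2 : b.2.val = 0 := by have := ZMod.val_lt b.2; omega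
  ext <;> simp_all [ZMod.val_eq_zero]

/-- Every `c ∉ 7ℤ[i]` is congruent to the representative of its class. [folklore] -/
theorem seven_dvd_rep_cls_sub (c : GaussianInt) : (7 : GaussianInt) ∣ rep 7 (cls 7 c) 0 - c := by
  rw [seven_dvd_iff]
  simp only [Zsqrtd.re_sub, Zsqrtd.im_sub, rep_re, rep_im, cls, Prod.snd_zero, Prod.fst_zero, mul_zero, add_zero,
    ZMod.val_intCast]
  omega

/-- The generating set of `K₇` is finite (at most `2 · 49` division values, by `7`-periodicity). [folklore] -/
theorem generators_finite :
    {x : ℂ | ∃ c : GaussianInt, ¬ (7 : GaussianInt) ∣ c ∧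
        (x = ℘[ofUpperHalfPlane UpperHalfPlane.I] (((c : GaussianInt) : ℂ) / 7) / ((Real.Gamma (1 / 4) ^ 2 / (2 * Real.sqrt (2 * Real.pi)) : ℝ) : ℂ) ^ 2 ∨
         x = ℘'[ofUpperHalfPlane UpperHalfPlane.I] (((c : GaussianInt) : ℂ) / 7) / (2 * ((Real.Gamma (1 / 4) ^ 2 / (2 * Real.sqrt (2 * Real.pi)) : ℝ) : ℂ) ^ 3))}.Finite := by
  refine Set.Finite.subset ((Set.finite_range (fun b : ZMod 7 × ZMod 7 ↦
      ℘[ofUpperHalfPlane UpperHalfPlane.I] (((rep 7 b 0 : GaussianInt) : ℂ) / 7) / ((Real.Gamma (1 / 4) ^ 2 / (2 * Real.sqrt (2 * Real.pi)) : ℝ) : ℂ) ^ 2)).union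
    (Set.finite_range (fun b : ZMod 7 × ZMod 7 ↦
      ℘'[ofUpperHalfPlane UpperHalfPlane.I] (((rep 7 b 0 : GaussianInt) : ℂ) / 7) / (2 * ((Real.Gamma (1 / 4) ^ 2 / (2 * Real.sqrt (2 * Real.pi)) : ℝ) : ℂ) ^ 3)))) ?_
  rintro x ⟨c, -, rfl | rfl⟩
  · left
    refine ⟨cls 7 c, ?_⟩
    exact (X_Y_eq_of_dvd_sub (seven_dvd_rep_cls_sub c)).1
  · right
    refine ⟨cls 7 c, ?_⟩
    exact (X_Y_eq_of_dvd_sub (seven_dvd_rep_cls_sub c)).2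

/-- **`K₇ / ℚ⟮i⟯` is finite-dimensional** (finitely many algebraic generators). [cite: SilvermanAEC2009, VIII.1] -/
theorem finiteDimensional_adjoin :
    FiniteDimensional ℚ⟮I⟯ (IntermediateField.adjoin ℚ⟮I⟯ {x : ℂ | ∃ c : GaussianInt, ¬ (7 : GaussianInt) ∣ c ∧
        (x = ℘[ofUpperHalfPlane UpperHalfPlane.I] (((c : GaussianInt) : ℂ) / 7) / ((Real.Gamma (1 / 4) ^ 2 / (2 * Real.sqrt (2 * Real.pi)) : ℝ) : ℂ) ^ 2 ∨
         x = ℘'[ofUpperHalfPlane UpperHalfPlane.I] (((c : GaussianInt) : ℂ) / 7) / (2 * ((Real.Gamma (1 / 4) ^ 2 / (2 * Real.sqrt (2 * Real.pi)) : ℝ) : ℂ) ^ 3))}) := by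
  haveI : Finite {x : ℂ | ∃ c : GaussianInt, ¬ (7 : GaussianInt) ∣ c ∧
        (x = ℘[ofUpperHalfPlane UpperHalfPlane.I] (((c : GaussianInt) : ℂ) / 7) / ((Real.Gamma (1 / 4) ^ 2 / (2 * Real.sqrt (2 * Real.pi)) : ℝ) : ℂ) ^ 2 ∨
         x = ℘'[ofUpperHalfPlane UpperHalfPlane.I] (((c : GaussianInt) : ℂ) / 7) / (2 * ((Real.Gamma (1 / 4) ^ 2 / (2 * Real.sqrt (2 * Real.pi)) : ℝ) : ℂ) ^ 3))} :=
    generators_finite.to_subtype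
  refine IntermediateField.finiteDimensional_adjoin fun x hx ↦ ?_
  obtain ⟨c, hc, rfl | rfl⟩ := hx
  · exact (isIntegral_X_Y hc).1.tower_top
  · exact (isIntegral_X_Y hc).2.tower_top

/-- ★ **`K₇ / ℚ⟮i⟯` is NORMAL**: its normal closure in `ℂ` is `K₇` itself, since every embedding lands in `K₇`.
[cite: SilvermanAEC2009, VIII.1] -/
theorem normal_adjoin :
    Normal ℚ⟮I⟯ (IntermediateField.adjoin ℚ⟮I⟯ {x : ℂ | ∃ c : GaussianInt, ¬ (7 : GaussianInt) ∣ c ∧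
        (x = ℘[ofUpperHalfPlane UpperHalfPlane.I] (((c : GaussianInt) : ℂ) / 7) / ((Real.Gamma (1 / 4) ^ 2 / (2 * Real.sqrt (2 * Real.pi)) : ℝ) : ℂ) ^ 2 ∨
         x = ℘'[ofUpperHalfPlane UpperHalfPlane.I] (((c : GaussianInt) : ℂ) / 7) / (2 * ((Real.Gamma (1 / 4) ^ 2 / (2 * Real.sqrt (2 * Real.pi)) : ℝ) : ℂ) ^ 3))}) := by
  haveI := finiteDimensional_adjoin
  set K := IntermediateField.adjoin ℚ⟮I⟯ {x : ℂ | ∃ c : GaussianInt, ¬ (7 : GaussianInt) ∣ c ∧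
        (x = ℘[ofUpperHalfPlane UpperHalfPlane.I] (((c : GaussianInt) : ℂ) / 7) / ((Real.Gamma (1 / 4) ^ 2 / (2 * Real.sqrt (2 * Real.pi)) : ℝ) : ℂ) ^ 2 ∨
         x = ℘'[ofUpperHalfPlane UpperHalfPlane.I] (((c : GaussianInt) : ℂ) / 7) / (2 * ((Real.Gamma (1 / 4) ^ 2 / (2 * Real.sqrt (2 * Real.pi)) : ℝ) : ℂ) ^ 3))}
    with hK
  have hle : IntermediateField.normalClosure ℚ⟮I⟯ K ℂ ≤ K := by
    refine normalClosure_le_iff.mpr fun φ x hx ↦ ?_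
    obtain ⟨y, rfl⟩ := AlgHom.mem_fieldRange.mp hx
    exact algHom_apply_mem_adjoin φ y
  have heq : IntermediateField.normalClosure ℚ⟮I⟯ K ℂ = K := le_antisymm hle (IntermediateField.le_normalClosure K)
  have hnc : IsNormalClosure ℚ⟮I⟯ K (IntermediateField.normalClosure ℚ⟮I⟯ K ℂ) :=
    Algebra.IsAlgebraic.isNormalClosure_normalClosure (fun x ↦ IsAlgClosed.splits _)
  have hN : Normal ℚ⟮I⟯ (IntermediateField.normalClosure ℚ⟮I⟯ K ℂ) := hnc.normal
  exact Normal.of_algEquiv (IntermediateField.equivOfEq heq)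

/-- **`K₇ / ℚ⟮i⟯` is GALOIS** (normal, and separable in characteristic `0`). [cite: SilvermanAEC2009, VIII.1] -/
theorem isGalois_adjoin :
    IsGalois ℚ⟮I⟯ (IntermediateField.adjoin ℚ⟮I⟯ {x : ℂ | ∃ c : GaussianInt, ¬ (7 : GaussianInt) ∣ c ∧
        (x = ℘[ofUpperHalfPlane UpperHalfPlane.I] (((c : GaussianInt) : ℂ) / 7) / ((Real.Gamma (1 / 4) ^ 2 / (2 * Real.sqrt (2 * Real.pi)) : ℝ) : ℂ) ^ 2 ∨
         x = ℘'[ofUpperHalfPlane UpperHalfPlane.I] (((c : GaussianInt) : ℂ) / 7) / (2 * ((Real.Gamma (1 / 4) ^ 2 / (2 * Real.sqrt (2 * Real.pi)) : ℝ) : ℂ) ^ 3))}) := by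
  haveI := finiteDimensional_adjoin
  haveI := normal_adjoin
  exact IsGalois.mk

end DivisionField

end Summit.BirchSwinnertonDyer.BirchSwinnertonDyer.Theorems.BiquadraticEisensteinDescentManinDatumSupercuspidalCMInertSevenDivisionGalois

end
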